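import Mathlib
import HarnessLib
import Summits.HubbardSuperconductivity.HubbardSuperconductivity.Theorems.KLProgrammeKLRegimeEngineTowerLipschitz

/-!
# Route `KLProgramme` — crux K3 ENGINE (stmt-HubbardSuperconductivity-20437 `KLRegimeEngineV17F2`), stub (e) proof-input «(e)-D-ROWS»: NONNEGATIVITY OF THE
# LIPSCHITZ STEP RIGHT SIDE (the `0 ≤ B` side condition of the sup form of the (Db) row)
# (seat hubbard-kl-k3c4-p1 g24, VL lane; pure real analysis)

The (Db) row is proved at every deep pin (`…TwoVolumeLipBornDiffHstep.klLipBornDiff_pinned_le_hstep`); T3-Lip reads the deep-pin SUPREMUM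
(`…LipDiffSups.klLipBornDiffSup_le_of_forall`, which needs the bound to be nonnegative for the empty case).  This file records that the Lipschitz step right side
`towerFO D σ ν q + Σ_{n∈[2,N]} eΦ^{n−1}ψ^q·towerSLip D τ ν μ n q + Ct·ψ^q e·V(μ)(ΦV(μ))^N/(1−ΦV(μ))` is nonnegative under the kit's guard `Φ·V(μ) < 1`
(nonnegative data), so the sup form is available with `B :=` (born unit) `×` (this right side) `+` SRC.

* `kitTail_nonneg`, **`kitStepLip_nonneg`**.

Pure real analysis; nothing about the model is asserted.
-/

noncomputable section

namespace Summit.HubbardSuperconductivity.HubbardSuperconductivity.Theorems.EngineV8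

set_option linter.dupNamespace false -- summit = problem name (single-conjunct summit), D-0017

open Real Finset

/-- The kit's geometric tail is nonnegative under the guard. -/
theorem kitTail_nonneg {D N q : ℕ} {τ Φ ψ Ct : ℝ} {μ : ℕ → ℝ} (hτ : 0 ≤ τ) (hΦ : 0 ≤ Φ) (hψ : 0 ≤ ψ) (hCt : 0 ≤ Ct) (hμ : ∀ m, 0 ≤ μ m)
    (hguard : Φ * towerV D τ μ < 1) :
    0 ≤ Ct * (ψ ^ q * exp 1 * towerV D τ μ * (Φ * towerV D τ μ) ^ N / (1 - Φ * towerV D τ μ)) := by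
  have hV : 0 ≤ towerV D τ μ := towerV_nonneg hτ hμ
  have h1 : 0 < 1 - Φ * towerV D τ μ := sub_pos.2 hguard
  positivity

/-- **The Lipschitz step right side is nonnegative** (nonnegative `σ, τ, Φ, ψ, Ct`, profiles `ν, μ ≥ 0`, guard `Φ·V(μ) < 1`). -/
theorem kitStepLip_nonneg {D N q : ℕ} {σ τ Φ ψ Ct : ℝ} {ν μ : ℕ → ℝ} (hσ : 0 ≤ σ) (hτ : 0 ≤ τ) (hΦ : 0 ≤ Φ) (hψ : 0 ≤ ψ) (hCt : 0 ≤ Ct)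
    (hν : ∀ m, 0 ≤ ν m) (hμ : ∀ m, 0 ≤ μ m) (hguard : Φ * towerV D τ μ < 1) :
    0 ≤ towerFO D σ ν q + ∑ n ∈ Icc 2 N, exp 1 * Φ ^ (n - 1) * ψ ^ q * towerSLip D τ ν μ n q +
      Ct * (ψ ^ q * exp 1 * towerV D τ μ * (Φ * towerV D τ μ) ^ N / (1 - Φ * towerV D τ μ)) := by
  have h1 : 0 ≤ towerFO D σ ν q := towerFO_nonneg hσ hν q
  have h2 : 0 ≤ ∑ n ∈ Icc 2 N, exp 1 * Φ ^ (n - 1) * ψ ^ q * towerSLip D τ ν μ n q :=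
    sum_nonneg fun n _ => by have := towerSLip_nonneg (D := D) hτ hν hμ n q; positivity
  have h3 := kitTail_nonneg (D := D) (N := N) (q := q) hτ hΦ hψ hCt hμ hguard
  linarith

end Summit.HubbardSuperconductivity.HubbardSuperconductivity.Theorems.EngineV8

end
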